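import Summits.QuantumFields.YangMills.Theorems.VirialFluxGapSheetKernelFix
import HarnessLib

/-!
# Route `VirialFluxGap` (YangMills): TWELVE ORTHONORMAL EXACT KERNEL VECTORS of the standard `X_fix` frame Hessian at a CENTRAL flat history
# (the (E2) kernel input `m = 12` of the central chart)

Brick (C1/(E2)) of the central charts for ⟨stmt-QuantumFields-24141⟩, the central twin of w2's ✓`exists_four_orthonormal_kernel_vectors`
(generic chart, `m = 4`).  At a CENTRAL comb-constant history `p_c = ((fun _ => combFlat h'), fun _ => c')` — every `h'_j` and `c'` with ZERO
imaginary part, i.e. `= ±1` — the data lie on EVERY axis, so w2's sheet-kernel lemmas (✓`frameHessRaw_mulVec_eq_zero_of_dirOf_eq_wrapBlockDir` ∕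
`…seamBlockDir`) apply with the three unit axes `e_1, e_2, e_3` at once: the `4 × 3` BLOCK-UNIFORM frame directions (`quatMatrix (zUnit a)` on the
wrap layer of direction `k`, resp. on the seam) are exact kernel vectors of the raw and of the symmetrised frame Hessian in the standard family
✓`fixFrameStd`, pairwise orthogonal (disjoint supports ∕ orthogonal half-Pauli coordinates `pauliCoord (quatMatrix (zUnit a)) = 2·e_{2−a}`):

  ★★★ `exists_twelve_orthonormal_kernel_vectors_central` : `∃ k : Fin 12 → FixVar L × Fin 3 → ℝ`, `k a ⬝ᵥ k b = δ_ab`,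
  `Ĥ(p_c) k_a = 0`, `H(p_c) k_a = 0` — the inputs `hon`/`hker` (with `m = 12`) of ✓`generic_divergence_upper` ∕ ✓`trace_resolvent_le` for the
  central chart: `½tr(A⁻¹H) ≤ ½(#ι − 12) + …`, i.e. together with ✓`blockZeroModeField_div_le` (`div X_z ≤ 6`) the count `18L⁴ + 3 − 12 + 6 = 18L⁴ − 3`.

HONEST FRAMING: linear algebra at the 16 central points; the Taylor transfer to the chart, (E1) off the family and the patching are NOT here;
⟨24141⟩ stays OPEN; the Yang–Mills mass gap is NOT proved; no summit is proved by a line.  THEOREMS ONLY (0 `def`, 0 `sorry`), standard axioms.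
Width seat `ym-line-sfw-p2-w3` g58 (cell ym-idea-1, free hands), `--supports stmt-QuantumFields-24141`.  References: [cite: Luscher1983, §2];
[cite: CosteEtAl1985].
-/

set_option autoImplicit false

noncomputable section

open scoped Matrix BigOperators Quaternion
open Matrix
open Literature.MathematicalPhysics.QuantumFieldTheory hiding SU2
open Literature.MathematicalPhysics.QuantumLattice

namespace Summit.QuantumFields.YangMills.Theorems.VirialFluxGap.FixFrame

open Summit.QuantumFields.YangMills.Theorems.FemtoTransferGap
open Summit.QuantumFields.YangMills.Theorems.FemtoTransferGap.TT
open Summit.QuantumFields.YangMills.Theorems.FemtoTransferGap.TwoLattice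
open Summit.QuantumFields.YangMills.Theorems.FemtoTransferGap.TwoLattice.Flat
open Summit.QuantumFields.YangMills.Theorems.VirialFluxGap.RingDeficit
open Summit.QuantumFields.YangMills.Theorems.VirialFluxGap.FrameDerivative
open Summit.QuantumFields.YangMills.Theorems.VirialFluxGap.FrameHessian
open Summit.QuantumFields.YangMills.Theorems.VirialFluxGap.RegularValley

variable {L : ℕ} [NeZero L]

/-! ## §1 Half-Pauli coordinates of the unit directions -/

omit [NeZero L] in
/-- `pauliCoord (quatMatrix u_0) = (0, 0, 2)`. [folklore] -/
theorem pauliCoord_quatMatrix_zUnit_zero : pauliCoord (quatMatrix (zUnit 0)) = ![0, 0, 2] := by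
  funext c
  fin_cases c <;> simp [pauliCoord, quatMatrix, zUnit]

omit [NeZero L] in
/-- `pauliCoord (quatMatrix u_1) = (0, 2, 0)`. [folklore] -/
theorem pauliCoord_quatMatrix_zUnit_one : pauliCoord (quatMatrix (zUnit 1)) = ![0, 2, 0] := by
  funext c
  fin_cases c <;> simp [pauliCoord, quatMatrix, zUnit]

omit [NeZero L] in
/-- `pauliCoord (quatMatrix u_2) = (2, 0, 0)`. [folklore] -/
theorem pauliCoord_quatMatrix_zUnit_two : pauliCoord (quatMatrix (zUnit 2)) = ![2, 0, 0] := by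
  funext c
  fin_cases c <;> simp [pauliCoord, quatMatrix, zUnit]

omit [NeZero L] in
/-- The half-Pauli coordinate vectors of different unit directions are orthogonal. [folklore] -/
theorem sum_pauliCoord_zUnit_mul_of_ne {a b : Fin 3} (hab : a ≠ b) :
    ∑ c : Fin 3, pauliCoord (quatMatrix (zUnit a)) c * pauliCoord (quatMatrix (zUnit b)) c = 0 := by
  fin_cases a <;> fin_cases b <;> first
    | exact absurd rfl hab
    | simp [Fin.sum_univ_three, pauliCoord_quatMatrix_zUnit_zero, pauliCoord_quatMatrix_zUnit_one, pauliCoord_quatMatrix_zUnit_two]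

omit [NeZero L] in
/-- The unit direction as a pure imaginary quaternion literal. [folklore] -/
theorem zUnit_eq_mk (a : Fin 3) : zUnit a = (⟨0, (zUnit a).imI, (zUnit a).imJ, (zUnit a).imK⟩ : ℍ) := by
  fin_cases a <;> rfl

omit [NeZero L] in
/-- `quatMatrix u_a ≠ 0`. [folklore] -/
theorem quatMatrix_zUnit_ne_zero (a : Fin 3) : quatMatrix (zUnit a) ≠ 0 := by
  rw [zUnit_eq_mk]
  refine quatMatrix_im_ne_zero ?_
  fin_cases a <;> simp [zUnit]

/-! ## §2 Orthogonality of block coordinate vectors with different directions or different blocks -/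

/-- Wrap blocks of different directions: orthogonal coordinates (disjoint supports), any two matrices. [folklore] -/
theorem fixCoord_wrap_dot_wrap_of_ne' {k k' : Fin 3} (hkk' : k ≠ k') (Y Y' : Matrix (Fin 2) (Fin 2) ℂ) :
    fixCoord (wrapBlockDir (L := L) k Y) ⬝ᵥ fixCoord (wrapBlockDir (L := L) k' Y') = 0 := by
  refine Finset.sum_eq_zero fun va _ => ?_
  rw [fixCoord_wrapBlockDir_apply, fixCoord_wrapBlockDir_apply]
  by_cases h : isWrapB (L := L) k (fixVar va.1) = true
  · have h' : ¬ isWrapB (L := L) k' (fixVar va.1) = true := fun h' => hkk' (eq_of_isWrapB h h')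
    rw [if_neg h', mul_zero]
  · rw [if_neg h, zero_mul]

/-- Wrap and seam blocks: orthogonal coordinates, any two matrices. [folklore] -/
theorem fixCoord_wrap_dot_seam' (k : Fin 3) (Y Y' : Matrix (Fin 2) (Fin 2) ℂ) :
    fixCoord (wrapBlockDir (L := L) k Y) ⬝ᵥ fixCoord (seamBlockDir (L := L) Y') = 0 := by
  refine Finset.sum_eq_zero fun va _ => ?_
  rw [fixCoord_wrapBlockDir_apply, fixCoord_seamBlockDir_apply]
  by_cases h : isWrapB (L := L) k (fixVar va.1) = true
  · rw [isSeamB_eq_false_of_isWrapB h, if_neg Bool.false_ne_true, mul_zero]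
  · rw [if_neg h, zero_mul]

/-- The same wrap block with two different unit directions: orthogonal coordinates (orthogonal half-Pauli coordinates). [folklore] -/
theorem fixCoord_wrap_dot_wrap_zUnit_of_ne (k : Fin 3) {a b : Fin 3} (hab : a ≠ b) :
    fixCoord (wrapBlockDir (L := L) k (quatMatrix (zUnit a))) ⬝ᵥ fixCoord (wrapBlockDir (L := L) k (quatMatrix (zUnit b))) = 0 := by
  rw [dotProduct, Fintype.sum_prod_type]
  refine Finset.sum_eq_zero fun v _ => ?_
  simp only [fixCoord_wrapBlockDir_apply]
  by_cases h : isWrapB (L := L) k (fixVar v) = true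
  · simp only [h, if_true]
    exact sum_pauliCoord_zUnit_mul_of_ne hab
  · simp [h]

/-- The seam block with two different unit directions: orthogonal coordinates. [folklore] -/
theorem fixCoord_seam_dot_seam_zUnit_of_ne {a b : Fin 3} (hab : a ≠ b) :
    fixCoord (seamBlockDir (L := L) (quatMatrix (zUnit a))) ⬝ᵥ fixCoord (seamBlockDir (L := L) (quatMatrix (zUnit b))) = 0 := by
  rw [dotProduct, Fintype.sum_prod_type]
  refine Finset.sum_eq_zero fun v _ => ?_
  simp only [fixCoord_seamBlockDir_apply]
  by_cases h : isSeamB (L := L) (fixVar v) = true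
  · simp only [h, if_true]
    exact sum_pauliCoord_zUnit_mul_of_ne hab
  · simp [h]

/-! ## §3 The twelve block vectors -/

/-- Different blocks: orthogonal. [folklore] -/
theorem blockVec_dot_of_block_ne {B B' : Fin 4} (hBB' : B ≠ B') (a a' : Fin 3) :
    (if h : B.val < 3 then fixCoord (wrapBlockDir (L := L) ⟨B.val, h⟩ (quatMatrix (zUnit a)))
      else fixCoord (seamBlockDir (L := L) (quatMatrix (zUnit a)))) ⬝ᵥ
    (if h : B'.val < 3 then fixCoord (wrapBlockDir (L := L) ⟨B'.val, h⟩ (quatMatrix (zUnit a')))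
      else fixCoord (seamBlockDir (L := L) (quatMatrix (zUnit a')))) = 0 := by
  by_cases hB : B.val < 3 <;> by_cases hB' : B'.val < 3
  · rw [dif_pos hB, dif_pos hB']
    refine fixCoord_wrap_dot_wrap_of_ne' (fun h => hBB' ?_) _ _
    exact Fin.ext (by simpa using congrArg Fin.val h)
  · rw [dif_pos hB, dif_neg hB']
    exact fixCoord_wrap_dot_seam' _ _ _
  · rw [dif_neg hB, dif_pos hB', dotProduct_comm]
    exact fixCoord_wrap_dot_seam' _ _ _
  · exfalso
    exact hBB' (Fin.ext (by omega))

/-- Same block, different directions: orthogonal. [folklore] -/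
theorem blockVec_dot_of_dir_ne (B : Fin 4) {a a' : Fin 3} (haa' : a ≠ a') :
    (if h : B.val < 3 then fixCoord (wrapBlockDir (L := L) ⟨B.val, h⟩ (quatMatrix (zUnit a)))
      else fixCoord (seamBlockDir (L := L) (quatMatrix (zUnit a)))) ⬝ᵥ
    (if h : B.val < 3 then fixCoord (wrapBlockDir (L := L) ⟨B.val, h⟩ (quatMatrix (zUnit a')))
      else fixCoord (seamBlockDir (L := L) (quatMatrix (zUnit a')))) = 0 := by
  by_cases hB : B.val < 3
  · rw [dif_pos hB, dif_pos hB]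
    exact fixCoord_wrap_dot_wrap_zUnit_of_ne _ haa'
  · rw [dif_neg hB, dif_neg hB]
    exact fixCoord_seam_dot_seam_zUnit_of_ne haa'

/-- Same block (given as an equation), different directions: orthogonal. [folklore] -/
theorem blockVec_dot_of_dir_ne' (B B' : Fin 4) (hBB' : B = B') {a a' : Fin 3} (haa' : a ≠ a') :
    (if h : B.val < 3 then fixCoord (wrapBlockDir (L := L) ⟨B.val, h⟩ (quatMatrix (zUnit a)))
      else fixCoord (seamBlockDir (L := L) (quatMatrix (zUnit a)))) ⬝ᵥ
    (if h : B'.val < 3 then fixCoord (wrapBlockDir (L := L) ⟨B'.val, h⟩ (quatMatrix (zUnit a')))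
      else fixCoord (seamBlockDir (L := L) (quatMatrix (zUnit a')))) = 0 := by
  subst hBB'
  exact blockVec_dot_of_dir_ne B haa'

/-- Every block vector is non-zero. [folklore] -/
theorem blockVec_dot_self_pos (B : Fin 4) (a : Fin 3) :
    0 < (if h : B.val < 3 then fixCoord (wrapBlockDir (L := L) ⟨B.val, h⟩ (quatMatrix (zUnit a)))
      else fixCoord (seamBlockDir (L := L) (quatMatrix (zUnit a)))) ⬝ᵥ
    (if h : B.val < 3 then fixCoord (wrapBlockDir (L := L) ⟨B.val, h⟩ (quatMatrix (zUnit a)))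
      else fixCoord (seamBlockDir (L := L) (quatMatrix (zUnit a)))) := by
  by_cases hB : B.val < 3
  · rw [dif_pos hB]
    exact fixCoord_wrap_dot_self_pos _ (quatMatrix_zUnit_conjTranspose a) (quatMatrix_zUnit_trace a) (quatMatrix_zUnit_ne_zero a)
  · rw [dif_neg hB]
    exact fixCoord_seam_dot_self_pos (quatMatrix_zUnit_conjTranspose a) (quatMatrix_zUnit_trace a) (quatMatrix_zUnit_ne_zero a)

/-- ★★ Every block vector is an exact kernel vector of the raw frame Hessian at a central history. [cite: Luscher1983, §2] -/
theorem frameHessRaw_mulVec_blockVec_central {h' : Fin 3 → SU2} {c' : SU2}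
    (him : ∀ j, (su2Quat (h' j)).imI = 0 ∧ (su2Quat (h' j)).imJ = 0 ∧ (su2Quat (h' j)).imK = 0)
    (hcim : (su2Quat c').imI = 0 ∧ (su2Quat c').imJ = 0 ∧ (su2Quat c').imK = 0) (B : Fin 4) (a : Fin 3) :
    frameHessRaw (L := L) fixFrameStd (ringCoord L (((fun _ => combFlat h'), fun _ => c') :
        (Fin (2 * L - 1 + 1) → GaugeConfig 3 L SU2) × (Site 3 L → SU2))) *ᵥ
      (if h : B.val < 3 then fixCoord (wrapBlockDir (L := L) ⟨B.val, h⟩ (quatMatrix (zUnit a)))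
        else fixCoord (seamBlockDir (L := L) (quatMatrix (zUnit a)))) = 0 := by
  -- the central data lie on the axis of `u_a` (with zero coordinates)
  have hh' : ∀ j, (su2Quat (h' j)).imI = (fun _ : Fin 3 => (0 : ℝ)) j * (zUnit a).imI ∧
      (su2Quat (h' j)).imJ = (fun _ : Fin 3 => (0 : ℝ)) j * (zUnit a).imJ ∧ (su2Quat (h' j)).imK = (fun _ : Fin 3 => (0 : ℝ)) j * (zUnit a).imK :=
    fun j => by simpa using him j
  have hc' : (su2Quat c').imI = (0 : ℝ) * (zUnit a).imI ∧ (su2Quat c').imJ = (0 : ℝ) * (zUnit a).imJ ∧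
      (su2Quat c').imK = (0 : ℝ) * (zUnit a).imK := by simpa using hcim
  have hQ : quatMatrix (zUnit a) = quatMatrix (⟨0, (zUnit a).imI, (zUnit a).imJ, (zUnit a).imK⟩ : ℍ) := by rw [← zUnit_eq_mk]
  by_cases hB : B.val < 3
  · rw [dif_pos hB]
    refine frameHessRaw_mulVec_eq_zero_of_dirOf_eq_wrapBlockDir fixFrameStd fixFrameStd_conjTranspose fixFrameStd_trace
      (zUnit a).imI (zUnit a).imJ (zUnit a).imK hh' hc' ⟨B.val, hB⟩ ?_
    rw [← hQ]
    exact dirOf_fixCoord_wrapBlockDir _ (quatMatrix_zUnit_conjTranspose a) (quatMatrix_zUnit_trace a)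
  · rw [dif_neg hB]
    refine frameHessRaw_mulVec_eq_zero_of_dirOf_eq_seamBlockDir fixFrameStd fixFrameStd_conjTranspose fixFrameStd_trace
      (zUnit a).imI (zUnit a).imJ (zUnit a).imK hh' hc' ?_
    rw [← hQ]
    exact dirOf_fixCoord_seamBlockDir (quatMatrix_zUnit_conjTranspose a) (quatMatrix_zUnit_trace a)

/-! ## §4 Twelve orthonormal kernel vectors -/

/-- A central comb-constant history is a zero of the deficit. [cite: Luscher1983, §2] -/
theorem ringDeficit_central_eq_zero {h' : Fin 3 → SU2} {c' : SU2}
    (him : ∀ j, (su2Quat (h' j)).imI = 0 ∧ (su2Quat (h' j)).imJ = 0 ∧ (su2Quat (h' j)).imK = 0)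
    (hcim : (su2Quat c').imI = 0 ∧ (su2Quat c').imJ = 0 ∧ (su2Quat c').imK = 0) :
    ringDeficit L (fun _ => false) (((fun _ => combFlat h'), fun _ => c') :
      (Fin (2 * L - 1 + 1) → GaugeConfig 3 L SU2) × (Site 3 L → SU2)) = 0 := by
  have hh' : ∀ j, (su2Quat (h' j)).imI = (fun _ : Fin 3 => (0 : ℝ)) j * (1 : ℝ) ∧
      (su2Quat (h' j)).imJ = (fun _ : Fin 3 => (0 : ℝ)) j * (0 : ℝ) ∧ (su2Quat (h' j)).imK = (fun _ : Fin 3 => (0 : ℝ)) j * (0 : ℝ) :=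
    fun j => by simpa using him j
  have hc' : (su2Quat c').imI = (0 : ℝ) * (1 : ℝ) ∧ (su2Quat c').imJ = (0 : ℝ) * (0 : ℝ) ∧ (su2Quat c').imK = (0 : ℝ) * (0 : ℝ) := by
    simpa using hcim
  have h := ringDeficit_comb_seamSheet_eq_zero (L := L) 1 0 0 hh' hc' 0
  rwa [multiCurve_zero, mul_one] at h

/-- ★★★ **TWELVE ORTHONORMAL EXACT KERNEL VECTORS at a central flat history.**  If every wrap representative `h'_j` and the seam value `c'`
have zero imaginary part (`= ±1`), then at `p_c = ((fun _ => combFlat h'), fun _ => c')`, in the standard frame family ✓`fixFrameStd`, there is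
`k : Fin 12 → ι → ℝ` with `k a ⬝ᵥ k b = δ_ab`, `Ĥ(p_c) k_a = 0` and `H(p_c) k_a = 0` — the inputs `hon`/`hker` with `m = 12` of
✓`generic_divergence_upper` for the CENTRAL chart. [cite: Luscher1983, §2] -/
theorem exists_twelve_orthonormal_kernel_vectors_central {h' : Fin 3 → SU2} {c' : SU2}
    (him : ∀ j, (su2Quat (h' j)).imI = 0 ∧ (su2Quat (h' j)).imJ = 0 ∧ (su2Quat (h' j)).imK = 0)
    (hcim : (su2Quat c').imI = 0 ∧ (su2Quat c').imJ = 0 ∧ (su2Quat c').imK = 0) :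
    ∃ k : Fin 12 → FixVar L × Fin 3 → ℝ, (∀ a b, k a ⬝ᵥ k b = if a = b then 1 else 0) ∧
      (∀ a, frameHessRaw (L := L) fixFrameStd (ringCoord L (((fun _ => combFlat h'), fun _ => c') :
          (Fin (2 * L - 1 + 1) → GaugeConfig 3 L SU2) × (Site 3 L → SU2))) *ᵥ k a = 0) ∧
      ∀ a, frameHess (L := L) fixFrameStd (ringCoord L (((fun _ => combFlat h'), fun _ => c') :
          (Fin (2 * L - 1 + 1) → GaugeConfig 3 L SU2) × (Site 3 L → SU2))) *ᵥ k a = 0 := by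
  -- index the `4 × 3` block vectors by `Fin 12` through `(i / 3, i % 3)`
  let κ : Fin 12 → FixVar L × Fin 3 → ℝ := fun i =>
    if h : (⟨i.val / 3, by omega⟩ : Fin 4).val < 3 then
      fixCoord (wrapBlockDir (L := L) ⟨(⟨i.val / 3, by omega⟩ : Fin 4).val, h⟩ (quatMatrix (zUnit ⟨i.val % 3, by omega⟩)))
    else fixCoord (seamBlockDir (L := L) (quatMatrix (zUnit ⟨i.val % 3, by omega⟩)))
  have horth : ∀ i j : Fin 12, i ≠ j → κ i ⬝ᵥ κ j = 0 := by
    intro i j hij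
    by_cases hB : (⟨i.val / 3, by omega⟩ : Fin 4) = ⟨j.val / 3, by omega⟩
    · have ha : (⟨i.val % 3, by omega⟩ : Fin 3) ≠ ⟨j.val % 3, by omega⟩ := by
        intro ha
        apply hij
        apply Fin.ext
        have h1 : i.val / 3 = j.val / 3 := by simpa using congrArg Fin.val hB
        have h2 : i.val % 3 = j.val % 3 := by simpa using congrArg Fin.val ha
        omega
      exact blockVec_dot_of_dir_ne' (L := L) _ _ hB ha
    · exact blockVec_dot_of_block_ne (L := L) hB _ _
  have hpos : ∀ i : Fin 12, 0 < κ i ⬝ᵥ κ i := fun i => blockVec_dot_self_pos (L := L) _ _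
  have hker : ∀ i : Fin 12, frameHessRaw (L := L) fixFrameStd (ringCoord L (((fun _ => combFlat h'), fun _ => c') :
      (Fin (2 * L - 1 + 1) → GaugeConfig 3 L SU2) × (Site 3 L → SU2))) *ᵥ κ i = 0 :=
    fun i => frameHessRaw_mulVec_blockVec_central him hcim _ _
  obtain ⟨k, hon, hk⟩ := exists_orthonormal_of_orthogonal_kernel κ horth hpos hker
  refine ⟨k, hon, hk, fun a => ?_⟩
  rw [frameHess_eq_frameHessRaw_of_zero fixFrameStd fixFrameStd_conjTranspose (ringDeficit_central_eq_zero him hcim)]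
  exact hk a

end Summit.QuantumFields.YangMills.Theorems.VirialFluxGap.FixFrame

end
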